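import Mathlib
import HarnessLib

/-!
# Determinants of cyclic block-bidiagonal matrices

For blocks `X₀, …, X_k ∈ M_σ(R)` over a commutative ring, the block matrix on `σ × Fin (k+1)` with
identity diagonal blocks and the block `X_t` in position `(t, t-1)` (indices mod `k+1`, so `X₀`
sits in the corner `(0, k)`) has determinant
`det (1 + cyclicSub X) = det (1 + (-1)^k X_k X_{k-1} ⋯ X₀)`
(`det_one_add_cyclicSub`). With invertible diagonal blocks `M_t` and sub-diagonal blocks `N_t` this
gives `det = ∏ det M_t · det (1 + (-1)^k ∏ M_t⁻¹ N_t)` (`det_cyclicBidiag`). This is the finite-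
dimensional ("first-quantised") form of the transfer-matrix evaluation of fermionic Gaussian
integrals on a time circle (antiperiodic trace `det(1 + T)`, periodic supertrace `det(1 - T)`),
e.g. Montvay–Münster, *Quantum Fields on a Lattice* (1994) §4.1.3; it is proved here by splitting
off the last time slice (Schur complement against the identity block) and induction on `k`.
All statements are proved; no named facts.
-/

noncomputable section

namespace Literature.LinearAlgebra.Matrix

open _root_.Matrix

variable {σ : Type*} [Fintype σ] [DecidableEq σ] {R : Type*} [CommRing R]

/-- The cyclic sub-diagonal block matrix of the blocks `X₀, …, X_k`: the block in position
`(t, s)` is `X_t` if `t = s + 1 (mod k+1)` and `0` otherwise (for `k = 0` it is the block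
diagonal matrix `X₀`). [folklore] -/
def cyclicSub {k : ℕ} (X : Fin (k + 1) → Matrix σ σ R) :
    Matrix (σ × Fin (k + 1)) (σ × Fin (k + 1)) R :=
  Matrix.of fun p q => if p.2 = q.2 + 1 then X p.2 p.1 q.1 else 0

omit [Fintype σ] [DecidableEq σ] in
/-- Entries of the cyclic sub-diagonal block matrix. [folklore] -/
@[simp] theorem cyclicSub_apply {k : ℕ} (X : Fin (k + 1) → Matrix σ σ R) (i j : σ) (t s : Fin (k + 1)) :
    cyclicSub X (i, t) (j, s) = if t = s + 1 then X t i j else 0 := rfl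

/-- The reversed ordered product `X_k ⋯ X₁ X₀`, first factor split off:
`X_k ⋯ X₀ = (X_k ⋯ X₁) · X₀`. [folklore] -/
theorem reverse_prod_ofFn_succ {M : Type*} [Monoid M] {k : ℕ} (X : Fin (k + 1) → M) :
    (List.ofFn X).reverse.prod = (List.ofFn fun i : Fin k => X i.succ).reverse.prod * X 0 := by
  rw [List.ofFn_succ, List.reverse_cons, List.prod_append, List.prod_singleton]

/-- The reversed ordered product, last factor split off: `X_{k} ⋯ X₀ = X_k · (X_{k-1} ⋯ X₀)`. [folklore] -/
theorem reverse_prod_ofFn_succ' {M : Type*} [Monoid M] {k : ℕ} (X : Fin (k + 1) → M) :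
    (List.ofFn X).reverse.prod = X (Fin.last k) * (List.ofFn fun i : Fin k => X i.castSucc).reverse.prod := by
  rw [List.ofFn_succ', List.concat_eq_append, List.reverse_append, List.prod_append,
    List.reverse_singleton, List.prod_singleton]

/-- The index splitting `σ × Fin (k+2) ≃ (σ × Fin (k+1)) ⊕ σ` separating the last time slice. [folklore] -/
def splitLast (σ : Type*) (k : ℕ) : σ × Fin (k + 2) ≃ (σ × Fin (k + 1)) ⊕ σ :=
  (((Equiv.refl σ).prodCongr finSumFinEquiv.symm).trans (Equiv.prodSumDistrib σ (Fin (k + 1)) (Fin 1))).trans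
    (Equiv.sumCongr (Equiv.refl _) (Equiv.prodUnique σ (Fin 1)))

omit [Fintype σ] [DecidableEq σ] in
/-- `splitLast` on the first `k + 1` slices. [folklore] -/
@[simp] theorem splitLast_symm_inl (k : ℕ) (i : σ) (t : Fin (k + 1)) :
    (splitLast σ k).symm (Sum.inl (i, t)) = (i, t.castSucc) := by
  simp [splitLast, Fin.castSucc]

omit [Fintype σ] [DecidableEq σ] in
/-- `splitLast` on the last slice. [folklore] -/
@[simp] theorem splitLast_symm_inr (k : ℕ) (i : σ) :
    (splitLast σ k).symm (Sum.inr i) = (i, Fin.last (k + 1)) := by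
  simp only [splitLast, Equiv.symm_trans_apply, Equiv.sumCongr_symm, Equiv.sumCongr_apply,
    Sum.map_inr, Equiv.prodSumDistrib_symm_apply_right, Equiv.prodCongr_symm, Equiv.refl_symm,
    Equiv.prodCongr_apply, Prod.map_apply, Equiv.refl_apply, Equiv.symm_symm,
    finSumFinEquiv_apply_right, Prod.mk.injEq]
  refine ⟨?_, Fin.ext ?_⟩
  · simp [Equiv.prodUnique]
  · simp

/-- **Determinant of the unipotent cyclic block-bidiagonal matrix**:
`det (1 + cyclicSub X) = det (1 + (-1)^k X_k ⋯ X₀)`. [folklore] -/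
theorem det_one_add_cyclicSub : ∀ {k : ℕ} (X : Fin (k + 1) → Matrix σ σ R),
    (1 + cyclicSub X).det = (1 + (-1 : R) ^ k • (List.ofFn X).reverse.prod).det
  | 0, X => by
    have h : (1 + cyclicSub X) = (1 + (List.ofFn X).reverse.prod).submatrix
        (Equiv.prodUnique σ (Fin 1)) (Equiv.prodUnique σ (Fin 1)) := by
      ext ⟨i, t⟩ ⟨j, s⟩
      have ht : t = 0 := Fin.eq_zero t
      have hs : s = 0 := Fin.eq_zero s
      subst ht hs
      simp [Matrix.one_apply, List.ofFn_succ]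
    rw [pow_zero, one_smul, h, Matrix.det_submatrix_equiv_self]
  | k + 1, X => by
    -- split off the last slice
    set e := splitLast σ k with he
    set X' : Fin (k + 1) → Matrix σ σ R := Fin.cons (-(X 0 * X (Fin.last (k + 1))))
      (fun i : Fin k => X i.succ.castSucc) with hX'
    have hA : Matrix.reindex e e (1 + cyclicSub X) =
        Matrix.fromBlocks (1 + Matrix.of fun p q : σ × Fin (k + 1) =>
            if p.2.castSucc = q.2.succ then X p.2.castSucc p.1 q.1 else 0)
          (Matrix.of fun (p : σ × Fin (k + 1)) (j : σ) => if p.2 = 0 then X 0 p.1 j else 0)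
          (Matrix.of fun (i : σ) (q : σ × Fin (k + 1)) => if q.2 = Fin.last k then X (Fin.last (k + 1)) i q.1 else 0)
          1 := by
      ext (⟨i, t⟩ | i) (⟨j, s⟩ | j)
      · simp only [Matrix.reindex_apply, Matrix.submatrix_apply, he, splitLast_symm_inl,
          Matrix.add_apply, Matrix.one_apply, cyclicSub_apply, Matrix.fromBlocks_apply₁₁,
          Matrix.of_apply, Prod.mk.injEq, Fin.castSucc_inj, Fin.coeSucc_eq_succ]
      · simp only [Matrix.reindex_apply, Matrix.submatrix_apply, he, splitLast_symm_inl,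
          splitLast_symm_inr, Matrix.add_apply, Matrix.one_apply, cyclicSub_apply,
          Matrix.fromBlocks_apply₁₂, Matrix.of_apply, Prod.mk.injEq, Fin.last_add_one]
        have h1 : t.castSucc ≠ Fin.last (k + 1) := Fin.castSucc_ne_last t
        simp only [h1, and_false, ↓reduceIte, zero_add, Fin.castSucc_eq_zero_iff]
        by_cases ht : t = 0
        · subst ht; simp
        · simp [ht]
      · simp only [Matrix.reindex_apply, Matrix.submatrix_apply, he, splitLast_symm_inl,
          splitLast_symm_inr, Matrix.add_apply, Matrix.one_apply, cyclicSub_apply,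
          Matrix.fromBlocks_apply₂₁, Matrix.of_apply, Prod.mk.injEq, Fin.coeSucc_eq_succ]
        have h1 : Fin.last (k + 1) ≠ s.castSucc := (Fin.castSucc_ne_last s).symm
        simp only [h1, and_false, ↓reduceIte, zero_add]
        by_cases hs : s = Fin.last k
        · subst hs; simp [Fin.succ_last]
        · have : Fin.last (k + 1) ≠ s.succ := fun h => hs (Fin.succ_injective _ (by rw [← h, Fin.succ_last]))
          simp [hs, this]
      · simp only [Matrix.reindex_apply, Matrix.submatrix_apply, he, splitLast_symm_inr,
          Matrix.add_apply, Matrix.one_apply, cyclicSub_apply, Matrix.fromBlocks_apply₂₂,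
          Prod.mk.injEq, and_true, Fin.last_add_one]
        have h1 : Fin.last (k + 1) ≠ 0 := fun h => by simpa using congrArg Fin.val h
        simp [h1]
    have hdet := Matrix.det_reindex_self e (1 + cyclicSub X)
    rw [hA, Matrix.det_fromBlocks_one₂₂] at hdet
    rw [← hdet]
    -- the Schur complement is the cyclic matrix of size `k + 1` with corner block `-(X₀ X_{k+1})`
    have hBC : (1 + Matrix.of fun p q : σ × Fin (k + 1) =>
            if p.2.castSucc = q.2.succ then X p.2.castSucc p.1 q.1 else 0) -
          (Matrix.of fun (p : σ × Fin (k + 1)) (j : σ) => if p.2 = 0 then X 0 p.1 j else 0) *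
          (Matrix.of fun (i : σ) (q : σ × Fin (k + 1)) =>
            if q.2 = Fin.last k then X (Fin.last (k + 1)) i q.1 else 0) = 1 + cyclicSub X' := by
      ext ⟨i, t⟩ ⟨j, s⟩
      have hmul : ((Matrix.of fun (p : σ × Fin (k + 1)) (j : σ) => if p.2 = 0 then X 0 p.1 j else 0) *
          (Matrix.of fun (i : σ) (q : σ × Fin (k + 1)) =>
            if q.2 = Fin.last k then X (Fin.last (k + 1)) i q.1 else 0)) (i, t) (j, s) =
          if t = 0 ∧ s = Fin.last k then (X 0 * X (Fin.last (k + 1))) i j else 0 := by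
        rw [Matrix.mul_apply]
        by_cases ht : t = 0 <;> by_cases hs : s = Fin.last k <;> simp [ht, hs, Matrix.mul_apply]
      rw [Matrix.sub_apply, hmul, Matrix.add_apply, Matrix.add_apply, Matrix.of_apply, cyclicSub_apply]
      rcases Fin.eq_zero_or_eq_succ t with rfl | ⟨t', rfl⟩
      · have h1 : ((0 : Fin (k + 1)).castSucc : Fin (k + 2)) ≠ s.succ := by
          rw [Fin.castSucc_zero]; exact (Fin.succ_ne_zero s).symm
        have h2 : ((0 : Fin (k + 1)) = s + 1) ↔ s = Fin.last k := by
          constructor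
          · intro h
            have : s + 1 = Fin.last k + 1 := by rw [Fin.last_add_one]; exact h.symm
            exact add_right_cancel this
          · rintro rfl; rw [Fin.last_add_one]
        simp only [h1, ↓reduceIte, add_zero, true_and, h2, hX', Fin.cons_zero, Matrix.neg_apply]
        split_ifs <;> ring
      · have h1 : (t'.succ.castSucc = s.succ) ↔ s = t'.castSucc := by
          rw [← Fin.succ_castSucc, Fin.succ_inj, eq_comm]
        have h2 : (t'.succ = s + 1) ↔ s = t'.castSucc := by
          rw [← Fin.coeSucc_eq_succ]
          exact ⟨fun h => (add_right_cancel h).symm, fun h => by rw [h]⟩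
        have h3 : t'.succ ≠ 0 := Fin.succ_ne_zero t'
        simp only [h1, h2, h3, false_and, ↓reduceIte, sub_zero, hX', Fin.cons_succ]
    rw [hBC, det_one_add_cyclicSub X']
    -- compare the two ordered products
    have hP : (List.ofFn X').reverse.prod =
        (List.ofFn fun i : Fin k => X i.succ.castSucc).reverse.prod * -(X 0 * X (Fin.last (k + 1))) := by
      rw [reverse_prod_ofFn_succ]
      simp [hX']
    have hQ : (List.ofFn X).reverse.prod =
        X (Fin.last (k + 1)) * ((List.ofFn fun i : Fin k => X i.succ.castSucc).reverse.prod * X 0) := by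
      rw [reverse_prod_ofFn_succ, reverse_prod_ofFn_succ']
      simp only [Fin.succ_last, Fin.succ_castSucc, mul_assoc]
    rw [hP, hQ]
    set P := (List.ofFn fun i : Fin k => X i.succ.castSucc).reverse.prod
    calc (1 + (-1 : R) ^ k • (P * -(X 0 * X (Fin.last (k + 1))))).det
        = (1 + ((-1 : R) ^ (k + 1) • (P * X 0)) * X (Fin.last (k + 1))).det := by
          congr 1
          simp only [pow_succ, mul_neg_one, neg_smul, Matrix.mul_neg, smul_neg, smul_mul_assoc,
            Matrix.mul_assoc, neg_mul]
      _ = (1 + X (Fin.last (k + 1)) * ((-1 : R) ^ (k + 1) • (P * X 0))).det :=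
          Matrix.det_one_add_mul_comm _ _
      _ = (1 + (-1 : R) ^ (k + 1) • (X (Fin.last (k + 1)) * (P * X 0))).det := by
          rw [Matrix.mul_smul]

/-- The product of the block diagonal matrix `diag(M_t)` with the unipotent cyclic matrix of the
blocks `X_t` is the cyclic block-bidiagonal matrix with diagonal blocks `M_t` and sub-diagonal
blocks `M_t X_t`. [folklore] -/
theorem blockDiagonal_mul_one_add_cyclicSub {k : ℕ} (M X : Fin (k + 1) → Matrix σ σ R) :
    Matrix.blockDiagonal M * (1 + cyclicSub X) = Matrix.of fun p q : σ × Fin (k + 1) =>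
      (if p.2 = q.2 then M p.2 p.1 q.1 else 0) + (if p.2 = q.2 + 1 then (M p.2 * X p.2) p.1 q.1 else 0) := by
  ext ⟨i, t⟩ ⟨j, s⟩
  rw [Matrix.mul_add, Matrix.mul_one, Matrix.add_apply, Matrix.blockDiagonal_apply, Matrix.of_apply]
  congr 1
  rw [Matrix.mul_apply, Fintype.sum_prod_type]
  have hx : ∀ (l : σ) (r : Fin (k + 1)), Matrix.blockDiagonal M (i, t) (l, r) * cyclicSub X (l, r) (j, s) =
      if t = r then (if t = s + 1 then M t i l * X t l j else 0) else 0 := by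
    intro l r
    rw [Matrix.blockDiagonal_apply, cyclicSub_apply]
    by_cases h : t = r
    · subst h; simp
    · simp [h]
  simp only [hx, Finset.sum_ite_eq, Finset.mem_univ, ↓reduceIte]
  by_cases h : t = s + 1
  · simp only [h, ↓reduceIte, Matrix.mul_apply]
  · simp [h]

/-- **Determinant of a cyclic block-bidiagonal matrix with invertible diagonal blocks**: for
blocks `M_t` (invertible) on the diagonal and `N_t` in position `(t, t-1 mod k+1)`,
`det = (∏ₜ det M_t) · det (1 + (-1)^k (M_k⁻¹N_k) ⋯ (M₀⁻¹N₀))`. [folklore] -/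
theorem det_cyclicBidiag {k : ℕ} (M N : Fin (k + 1) → Matrix σ σ R) (hM : ∀ t, IsUnit (M t).det) :
    (Matrix.of fun p q : σ × Fin (k + 1) =>
      (if p.2 = q.2 then M p.2 p.1 q.1 else 0) + (if p.2 = q.2 + 1 then N p.2 p.1 q.1 else 0)).det =
      (∏ t, (M t).det) * (1 + (-1 : R) ^ k • (List.ofFn fun t => (M t)⁻¹ * N t).reverse.prod).det := by
  have h := blockDiagonal_mul_one_add_cyclicSub M (fun t => (M t)⁻¹ * N t)
  simp only [Matrix.mul_nonsing_inv_cancel_left _ _ (hM _)] at h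
  rw [← h, Matrix.det_mul, Matrix.det_blockDiagonal, det_one_add_cyclicSub]

/-! ## Ordered products: telescoping and rotation -/

section Telescope

variable {M : Type*} [Monoid M]

/-- **Telescoping of conjugated factors in an ordered product.** For `X_t = Λ_t f_t Λ'_t`,
`(X_k ⋯ X₀) E = Λ_k · ∏_{t=k}^{0} (f_t Λ'_t Λ_{t-1})` with the convention `Λ_{-1} := E`. [folklore] -/
theorem reverse_prod_ofFn_conj_mul : ∀ {k : ℕ} (Λ f Λ' : Fin (k + 1) → M) (E : M),
    (List.ofFn fun t => Λ t * f t * Λ' t).reverse.prod * E =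
      Λ (Fin.last k) * (List.ofFn fun t => f t * Λ' t *
        Fin.cases (motive := fun _ => M) E (fun t' => Λ t'.castSucc) t).reverse.prod
  | 0, Λ, f, Λ', E => by
    simp [List.ofFn_succ, mul_assoc]
  | k + 1, Λ, f, Λ', E => by
    rw [reverse_prod_ofFn_succ (fun t => Λ t * f t * Λ' t),
      reverse_prod_ofFn_succ (fun t => f t * Λ' t * Fin.cases (motive := fun _ => M) E (fun t' => Λ t'.castSucc) t)]
    have ih := reverse_prod_ofFn_conj_mul (fun t => Λ t.succ) (fun t => f t.succ) (fun t => Λ' t.succ) (Λ 0)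
    simp only [Fin.cases_zero, Fin.cases_succ]
    calc (List.ofFn fun i : Fin (k + 1) => Λ i.succ * f i.succ * Λ' i.succ).reverse.prod * (Λ 0 * f 0 * Λ' 0) * E
        = ((List.ofFn fun i : Fin (k + 1) => Λ i.succ * f i.succ * Λ' i.succ).reverse.prod * Λ 0) *
            (f 0 * Λ' 0 * E) := by simp only [mul_assoc]
      _ = Λ (Fin.last k).succ * (List.ofFn fun t : Fin (k + 1) => f t.succ * Λ' t.succ *
            Fin.cases (motive := fun _ => M) (Λ 0) (fun t' => Λ t'.castSucc.succ) t).reverse.prod *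
            (f 0 * Λ' 0 * E) := by rw [ih]
      _ = _ := by
        rw [Fin.succ_last, mul_assoc]
        have hfun : (fun t : Fin (k + 1) => f t.succ * Λ' t.succ *
            Fin.cases (motive := fun _ => M) (Λ 0) (fun t' => Λ t'.castSucc.succ) t) =
            (fun i : Fin (k + 1) => f i.succ * Λ' i.succ * Λ i.castSucc) := by
          funext t
          congr 1
          refine Fin.cases ?_ (fun t' => ?_) t
          · simp
          · simp only [Fin.cases_succ, Fin.succ_castSucc]
        rw [hfun]

end Telescope




section Aux

variable {n : Type*} [Fintype n] [DecidableEq n] {R : Type*} [CommRing R]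

/-- Negating every factor of an ordered product of `k + 1` matrices multiplies it by
`(-1)^(k+1)`. [folklore] -/
theorem reverse_prod_ofFn_neg : ∀ {k : ℕ} (F : Fin (k + 1) → Matrix n n R),
    (List.ofFn fun t => -F t).reverse.prod = (-1 : R) ^ (k + 1) • (List.ofFn F).reverse.prod
  | 0, F => by simp [List.ofFn_succ]
  | k + 1, F => by
    rw [reverse_prod_ofFn_succ (fun t => -F t), reverse_prod_ofFn_succ F,
      reverse_prod_ofFn_neg (fun i : Fin (k + 1) => F i.succ)]
    simp only [Matrix.mul_neg, Matrix.neg_mul, neg_neg, smul_mul_assoc, pow_succ, mul_neg_one, neg_smul]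

/-- `det (1 + c A) = det (1 + c Q)` when `A G = G Q` for an invertible `G` (similar matrices). [folklore] -/
theorem det_one_add_smul_eq_of_mul_eq {G A Q : Matrix n n R} (hG : IsUnit G.det) (c : R)
    (h : A * G = G * Q) : (1 + c • A).det = (1 + c • Q).det := by
  have hA : A = G * Q * G⁻¹ := by
    rw [← h, Matrix.mul_nonsing_inv_cancel_right _ _ hG]
  rw [hA, ← smul_mul_assoc, Matrix.det_one_add_mul_comm, Matrix.mul_smul, ← Matrix.mul_assoc,
    Matrix.nonsing_inv_mul _ hG, Matrix.one_mul]

end Aux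

end Literature.LinearAlgebra.Matrix

end
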